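import Summits.QuantumFields.YangMills.Theorems.LocalInsertionExpMomentSU2TorusUniformT3
import Summits.QuantumFields.YangMills.Theorems.LocalInsertionSublevelDoublingOneSitePartition
import Literature.MathematicalPhysics.QuantumFieldTheory.Balaban1983to89.B10Eq5RegularAction
import HarnessLib

/-!
# The SHARP mean plaquette: `∫ |U(∂p) − 1|² dμ_β ≤ C/β` and `∫ (1 − Re tr U(∂p)) dμ_β ≤ C/β`, volume-free, for `SU(2)` on Bałaban's `T^{(0)}_K`

Cell `ym3-torus` (HUMAN RULING D-0037, rung R3), width seat `ym3-torus-px5` gen 10; FILE 3 of the (THIN-RECT) lane = the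
`(1 + log β_K)·β_K⁻¹` row of `stub_thinRect` (LINE 28 v3 draft, w2-19936 g15) WITH ROOM.  The tree holds the β- and volume-uniform
Gaussian single-plaquette tail ✓`LocalInsertion.ExpMomentSU2UniformT3.exists_gibbsMeasure_real_dist1_ge_le_uniform_T3`
(`μ_β{θ ≤ |U(∂p) − 1|} ≤ e^{A}·e^{−βθ²/8}`, `β ≥ 8`, modulo the one-site doubling, discharged by
✓`LocalInsertion.SublevelDoubling.oneSite_partitionFunction_doubling_su2_d3`) and its FIRST-moment consequence
`∫|U(∂p) − 1| ≤ C/√β` (`exists_integral_dist1_le_uniform_T3`).  Here the SECOND moment, by Cavalieri in `s = θ²`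
(`integral_sq_le_of_gaussian_tail`: `μ{θ ≤ f} ≤ M e^{−cθ²}` ⇒ `∫ f² ≤ M/c`):

* `exists_integral_dist1_sq_le_uniform_T3`: `∃ C, ∀ F K β ≥ 8, ∀ p, ∫ dist1(U(∂p))² d(gibbsMeasure (F.P K) β) ≤ C/β`;
* `exists_integral_one_sub_reTr_le_uniform_T3`: the same for `1 − reTr U(∂p) ≤ ½ dist1²` ([Balaban1985UV3] (11));
* `exists_integral_dist1_sq_gibbsK_le_uniform` / `exists_integral_one_sub_reTr_gibbsK_le_uniform`: read on the tower laws
  `gibbsK F ℰ γ K` (`β = β_K`).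

Everything here is proved; no definitions; `N = 2`, `d = 3` (the tree's doubling input is `SU(2)`, `d = 3`).
-/

open MeasureTheory
open scoped Matrix.Norms.L2Operator

namespace Summit.QuantumFields.YangMills.Theorems.UnitScaleGibbsPlaquetteSecondMoment

open Literature.MathematicalPhysics.QuantumFieldTheory
open Literature.MathematicalPhysics.QuantumFieldTheory.Balaban1983to89
open Literature.MathematicalPhysics.QuantumFieldTheory.Balaban1983to89.T3ContinuumYM3Torus
open Literature.MathematicalPhysics.QuantumFieldTheory.Balaban1983to89.T3UnitScaleTilt
open Literature.MathematicalPhysics.QuantumLattice (fundamentalRep)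
open Summit.QuantumFields.YangMills.Theorems.LocalInsertion.ExpMomentSU2UniformT3
  (exists_gibbsMeasure_real_dist1_ge_le_uniform_T3)
open Summit.QuantumFields.YangMills.Theorems.LocalInsertion.SublevelDoubling (oneSite_partitionFunction_doubling_su2_d3)

noncomputable section

/-! ## §1 Cavalieri against a Gaussian tail, second moment -/

/-- **Cavalieri against a Gaussian tail, second moment**: if `f ≥ 0`, `f²` is integrable and `μ{θ ≤ f} ≤ M·e^{−cθ²}` for all
`θ > 0` (`c > 0`, `μ` finite), then `∫ f² dμ ≤ M/c` (`μ{s < f²} ≤ μ{√s ≤ f} ≤ M e^{−cs}`, `∫₀^∞ e^{−cs} ds = 1/c`). [folklore] -/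
theorem integral_sq_le_of_gaussian_tail {Ω : Type*} [MeasurableSpace Ω] {μ : Measure Ω} [IsFiniteMeasure μ] {f : Ω → ℝ}
    (hf0 : ∀ ω, 0 ≤ f ω) (hfi : Integrable (fun ω => f ω ^ 2) μ) {M c : ℝ} (hc : 0 < c)
    (htail : ∀ θ : ℝ, 0 < θ → μ.real {ω | θ ≤ f ω} ≤ M * Real.exp (-c * θ ^ 2)) :
    ∫ ω, f ω ^ 2 ∂μ ≤ M / c := by
  rw [hfi.integral_eq_integral_meas_lt (ae_of_all _ fun ω => sq_nonneg (f ω))]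
  have hgi : IntegrableOn (fun t : ℝ => M * Real.exp (-c * t)) (Set.Ioi 0) :=
    (exp_neg_integrableOn_Ioi 0 hc).const_mul M
  have h2 : ∫ t in Set.Ioi 0, Real.exp (-c * t) = c⁻¹ := by
    have h := integral_comp_mul_left_Ioi (fun x => Real.exp (-x)) 0 hc
    simp only [mul_zero, integral_exp_neg_Ioi_zero, smul_eq_mul, mul_one] at h
    simp only [neg_mul]
    exact h
  calc ∫ t in Set.Ioi 0, μ.real {a | t < f a ^ 2}
      ≤ ∫ t in Set.Ioi 0, M * Real.exp (-c * t) := by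
        refine integral_mono_of_nonneg (ae_of_all _ fun t => measureReal_nonneg) hgi ?_
        refine (ae_restrict_iff' measurableSet_Ioi).2 (ae_of_all _ fun t (ht : 0 < t) => ?_)
        have hsub : {a | t < f a ^ 2} ⊆ {a | Real.sqrt t ≤ f a} := fun a (ha : t < f a ^ 2) => by
          have h1 : Real.sqrt t < Real.sqrt (f a ^ 2) := Real.sqrt_lt_sqrt ht.le ha
          rw [Real.sqrt_sq (hf0 a)] at h1
          exact h1.le
        refine (measureReal_mono hsub).trans ((htail (Real.sqrt t) (Real.sqrt_pos.2 ht)).trans_eq ?_)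
        rw [Real.sq_sqrt ht.le]
    _ = M / c := by rw [integral_const_mul, h2, div_eq_mul_inv]

/-! ## §2 The second moment of the plaquette deviation under `gibbsMeasure (F.P K) β`, `β ≥ 8` -/

/-- `dist1 W² ≤ 4N` for `W ∈ SU(N)` (`dist1² ≤ 2N(1 − Re tr W)`, `Re tr W ≥ −1`). [cite: Balaban1985UV3, (11) p.258] -/
theorem dist1_sq_le_four_mul {N : ℕ} [NeZero N] (W : Matrix.specialUnitaryGroup (Fin N) ℂ) :
    dist1 W ^ 2 ≤ 4 * N := by
  have h := B10Eq71TorusLocal.dist1_sq_le_specialUnitaryGroup W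
  have h1 : -1 ≤ reTr W := RegularGaugeGroup.neg_one_le_reTr W
  have hN : (0 : ℝ) ≤ N := Nat.cast_nonneg _
  nlinarith

/-- The squared plaquette deviation `U ↦ dist1(U(∂p))²` is integrable under `gibbsMeasure P β`, `β ≥ 0` (bounded by `4N`, measurable).
[folklore] -/
theorem integrable_dist1_plaqHol_sq {N : ℕ} [NeZero N] (P : Params) {β : ℝ} (hβ : 0 ≤ β) (p : Plaq P 0) :
    Integrable (fun U : GaugeField P 0 (Matrix.specialUnitaryGroup (Fin N) ℂ) => dist1 (GaugeField.plaqHol U p) ^ 2)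
      (T4GenFunBounds.gibbsMeasure P β) := by
  haveI := T4GenFunBounds.isProbabilityMeasure_gibbsMeasure (G := Matrix.specialUnitaryGroup (Fin N) ℂ) P hβ
  have hm : Measurable fun U : GaugeField P 0 (Matrix.specialUnitaryGroup (Fin N) ℂ) => dist1 (GaugeField.plaqHol U p) ^ 2 :=
    (RegularGaugeGroup.measurable_dist1.comp (Missing.measurable_plaqHol p)).pow_const 2
  refine (integrable_const (4 * (N : ℝ))).mono' hm.aestronglyMeasurable (ae_of_all _ fun U => ?_)
  rw [Real.norm_eq_abs, abs_of_nonneg (sq_nonneg _)]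
  exact dist1_sq_le_four_mul _

/-- ★ **THE SHARP MEAN PLAQUETTE, SECOND MOMENT, MODULO THE ONE-SITE DOUBLING**: `hONE → ∃ C, ∀ F K β, 8 ≤ β → ∀ p,
∫ dist1(U(∂p))² d(gibbsMeasure (F.P K) β) ≤ C/β` (`C = 8e^{A}` from the uniform Gaussian tail at `c = β/8`) — the true `1/β` scale, NO
logarithm, NO power of the volume. [cite: Chatterjee2016, Thm. 2.1; Balaban1985UV3, (11) p.258] -/
theorem exists_integral_dist1_sq_le_uniform_T3_of_oneSiteDoubling
    (hONE : ∃ K : ℝ, ∀ t : ℝ, 0 < t →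
      (partitionFunction (d := 3) (L := 1) (fundamentalRep (Fin 2)) (t / 4)).toReal ≤
        K * (partitionFunction (d := 3) (L := 1) (fundamentalRep (Fin 2)) t).toReal) :
    ∃ C : ℝ, 0 ≤ C ∧ ∀ (F : T3Family) (K : ℕ) (β : ℝ), 8 ≤ β → ∀ p : Plaq (F.P K) 0,
      ∫ U : GaugeField (F.P K) 0 (Matrix.specialUnitaryGroup (Fin 2) ℂ), dist1 (GaugeField.plaqHol U p) ^ 2
        ∂(T4GenFunBounds.gibbsMeasure (F.P K) β) ≤ C / β := by
  obtain ⟨A, hGT⟩ := exists_gibbsMeasure_real_dist1_ge_le_uniform_T3 hONE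
  refine ⟨8 * Real.exp A, by positivity, fun F K β hβ p => ?_⟩
  have hβ0 : 0 < β := by linarith
  have hc : 0 < β / 8 := by positivity
  have htail : ∀ θ : ℝ, 0 < θ → (T4GenFunBounds.gibbsMeasure (F.P K) β).real
      {U : GaugeField (F.P K) 0 (Matrix.specialUnitaryGroup (Fin 2) ℂ) | θ ≤ dist1 (GaugeField.plaqHol U p)} ≤
        Real.exp A * Real.exp (-(β / 8) * θ ^ 2) := by
    intro θ hθ
    have h := hGT F K β hβ θ hθ.le p
    rwa [show -(1 / 2 * (β / 2) * θ ^ 2 / 2) = -(β / 8) * θ ^ 2 by ring] at h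
  haveI := T4GenFunBounds.isProbabilityMeasure_gibbsMeasure (G := Matrix.specialUnitaryGroup (Fin 2) ℂ) (F.P K) hβ0.le
  refine (integral_sq_le_of_gaussian_tail (fun U => GaugeGroup.dist1_nonneg _)
    (integrable_dist1_plaqHol_sq (F.P K) hβ0.le p) hc htail).trans (le_of_eq ?_)
  field_simp

/-- ★★ **THE SHARP MEAN PLAQUETTE, SECOND MOMENT, UNCONDITIONALLY** (`hONE` = ✓`oneSite_partitionFunction_doubling_su2_d3`):
`∃ C ≥ 0, ∀ F K β, 8 ≤ β → ∀ p, ∫ dist1(U(∂p))² d(gibbsMeasure (F.P K) β) ≤ C/β`. [cite: Chatterjee2016, Thm. 2.1; Balaban1985UV3, (11) p.258] -/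
theorem exists_integral_dist1_sq_le_uniform_T3 :
    ∃ C : ℝ, 0 ≤ C ∧ ∀ (F : T3Family) (K : ℕ) (β : ℝ), 8 ≤ β → ∀ p : Plaq (F.P K) 0,
      ∫ U : GaugeField (F.P K) 0 (Matrix.specialUnitaryGroup (Fin 2) ℂ), dist1 (GaugeField.plaqHol U p) ^ 2
        ∂(T4GenFunBounds.gibbsMeasure (F.P K) β) ≤ C / β :=
  exists_integral_dist1_sq_le_uniform_T3_of_oneSiteDoubling oneSite_partitionFunction_doubling_su2_d3

/-- ★★ **THE SHARP MEAN PLAQUETTE, ACTION FORM**: `∃ C ≥ 0, ∀ F K β, 8 ≤ β → ∀ p, ∫ (1 − reTr U(∂p)) d(gibbsMeasure (F.P K) β) ≤ C/β`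
(`1 − Re tr W ≤ ½|W − 1|²`, ✓`B10Eq5RegularAction.one_sub_reTr_le_specialUnitaryGroup`). [cite: Balaban1985UV3, (11) p.258] -/
theorem exists_integral_one_sub_reTr_le_uniform_T3 :
    ∃ C : ℝ, 0 ≤ C ∧ ∀ (F : T3Family) (K : ℕ) (β : ℝ), 8 ≤ β → ∀ p : Plaq (F.P K) 0,
      ∫ U : GaugeField (F.P K) 0 (Matrix.specialUnitaryGroup (Fin 2) ℂ), (1 - reTr (GaugeField.plaqHol U p))
        ∂(T4GenFunBounds.gibbsMeasure (F.P K) β) ≤ C / β := by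
  obtain ⟨C, hC0, hC⟩ := exists_integral_dist1_sq_le_uniform_T3
  refine ⟨C / 2, by positivity, fun F K β hβ p => ?_⟩
  have hβ0 : 0 < β := by linarith
  haveI := T4GenFunBounds.isProbabilityMeasure_gibbsMeasure (G := Matrix.specialUnitaryGroup (Fin 2) ℂ) (F.P K) hβ0.le
  have hpt : ∀ U : GaugeField (F.P K) 0 (Matrix.specialUnitaryGroup (Fin 2) ℂ),
      1 - reTr (GaugeField.plaqHol U p) ≤ (1 / 2) * dist1 (GaugeField.plaqHol U p) ^ 2 := fun U =>
    B10Eq5RegularAction.one_sub_reTr_le_specialUnitaryGroup _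
  have hint := ((integrable_dist1_plaqHol_sq (N := 2) (F.P K) hβ0.le p).const_mul (1 / 2))
  calc ∫ U, (1 - reTr (GaugeField.plaqHol U p)) ∂(T4GenFunBounds.gibbsMeasure (F.P K) β)
      ≤ ∫ U, (1 / 2) * dist1 (GaugeField.plaqHol U p) ^ 2 ∂(T4GenFunBounds.gibbsMeasure (F.P K) β) :=
        integral_mono_of_nonneg (ae_of_all _ fun U => sub_nonneg.2 (GaugeGroup.reTr_le_one _)) hint (ae_of_all _ hpt)
    _ = (1 / 2) * ∫ U, dist1 (GaugeField.plaqHol U p) ^ 2 ∂(T4GenFunBounds.gibbsMeasure (F.P K) β) := integral_const_mul _ _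
    _ ≤ (1 / 2) * (C / β) := mul_le_mul_of_nonneg_left (hC F K β hβ p) (by norm_num)
    _ = C / 2 / β := by ring

/-! ## §3 Read on the tower laws `gibbsK F ℰ γ K` (`β = β_K`) -/

/-- ★★ Second moment of the plaquette deviation under `gibbsK`: `∃ C ≥ 0, ∀ F ℰ γ K, 8 ≤ β_K → ∀ p, ∫ dist1(U(∂p))² ∂(gibbsK F ℰ γ K) ≤ C/β_K`.
[cite: Chatterjee2016, Thm. 2.1; Balaban1985UV3, (7) p.257] -/
theorem exists_integral_dist1_sq_gibbsK_le_uniform :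
    ∃ C : ℝ, 0 ≤ C ∧ ∀ (F : T3Family) (ℰ : LoopAverage (Matrix.specialUnitaryGroup (Fin 2) ℂ)) (γ : ℝ) (K : ℕ),
      8 ≤ (F.scheme ℰ γ).β K → ∀ p : Plaq (F.P K) 0,
        ∫ U, dist1 (GaugeField.plaqHol U p) ^ 2 ∂(gibbsK F ℰ γ K) ≤ C / (F.scheme ℰ γ).β K := by
  obtain ⟨C, hC0, h⟩ := exists_integral_dist1_sq_le_uniform_T3
  refine ⟨C, hC0, fun F ℰ γ K hβ p => ?_⟩
  rw [gibbsK_eq]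
  exact h F K ((F.scheme ℰ γ).β K) hβ p

/-- ★★ Mean plaquette action under `gibbsK`: `∃ C ≥ 0, ∀ F ℰ γ K, 8 ≤ β_K → ∀ p, ∫ (1 − reTr U(∂p)) ∂(gibbsK F ℰ γ K) ≤ C/β_K`.
[cite: Balaban1985UV3, (7) p.257 and (11) p.258] -/
theorem exists_integral_one_sub_reTr_gibbsK_le_uniform :
    ∃ C : ℝ, 0 ≤ C ∧ ∀ (F : T3Family) (ℰ : LoopAverage (Matrix.specialUnitaryGroup (Fin 2) ℂ)) (γ : ℝ) (K : ℕ),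
      8 ≤ (F.scheme ℰ γ).β K → ∀ p : Plaq (F.P K) 0,
        ∫ U, (1 - reTr (GaugeField.plaqHol U p)) ∂(gibbsK F ℰ γ K) ≤ C / (F.scheme ℰ γ).β K := by
  obtain ⟨C, hC0, h⟩ := exists_integral_one_sub_reTr_le_uniform_T3
  refine ⟨C, hC0, fun F ℰ γ K hβ p => ?_⟩
  rw [gibbsK_eq]
  exact h F K ((F.scheme ℰ γ).β K) hβ p

end

end Summit.QuantumFields.YangMills.Theorems.UnitScaleGibbsPlaquetteSecondMoment
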